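import Mathlib
import HarnessLib
import Summits.AtomisticToContinuum.FouriersLaw.Theses.HoelderEscapeProfile
import Summits.AtomisticToContinuum.FouriersLaw.Theorems.HoelderEscapeProfileLocalEnergyHalfHoelderStubStaticRiesz
import Summits.AtomisticToContinuum.FouriersLaw.Theorems.HoelderEscapeProfileLocalEnergyHalfHoelderStubPulseBounded
import Literature.MathematicalPhysics.KineticTheory.InfiniteChainCurrentPositiveType
import Literature.MathematicalPhysics.KineticTheory.InfiniteChainPartialMomentumReversal
import Literature.MathematicalPhysics.KineticTheory.InfiniteChainGoodSetSymmetries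
import Literature.MathematicalPhysics.KineticTheory.InfiniteChainShiftInvariantUniqueness
import Literature.MathematicalPhysics.KineticTheory.InfiniteChainEnergyDensityMoments
import Literature.MathematicalPhysics.KineticTheory.InfiniteChainGibbsBondForceByParts

/-!
# Stub `stub_doublingIdentity` of line `Sketch` (crux `HoelderEscapeProfile.LocalEnergyHalfHoelder`,
# item stmt-AtomisticToContinuum-16008): the time-reversal DOUBLING IDENTITY at finite rank

Support file (closes nothing; `--supports stmt-AtomisticToContinuum-16008`).  For the guarded pair
`(μ, D)` of the pinned anharmonic chain at temperature `T` (a shift-invariant DLR state `μ`, a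
`μ`-preserving dynamics `D` whose flow commutes a.e. with the unit lattice shift), the split-bond
site energy `h`, `m = ∫ h_0 dμ`, `h̃_z = h_z - m` and the pulse `S(x,t) = ∫ h̃_0 (h̃_x ∘ φ_t) dμ`:
for every time `s`, window `W = {-L, …, L}`, every solution `ap` of the finite normal equations
`S(-y,s) = Σ_{x∈W} ap_x S(x-y,0)` (`y ∈ W`) and EVERY coefficient vector `am`,

  `∫ (h̃_0∘φ_{-s} - Σ am_x h̃_x)(h̃_0∘φ_s - Σ ap_x h̃_x) dμ = S(0,2s) - Σ_x ap_x S(x,s)`.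

Proof.  All four functions are in `L²(μ)` (superstability of the shift-invariant DLR state,
`hasSuperstabilityEstimate_of_isShiftInvariant_pinnedChain` + `memLp_energyDensityZ_pinnedChain`,
and `MemLp.comp_measurePreserving` along `φ_{±s}`), so the integral expands by bilinearity into
`∫ u₋u₊ - Σ ap_x ∫ u₋h̃_x - Σ am_x ∫ h̃_x u₊ + ΣΣ am_x ap_y ∫ h̃_x h̃_y`.  Four identities:
(A) `∫ u₋u₊ = S(0,2s)` and (B) `∫ u₋ h̃_x = S(x,s)` by UNITARITY (substitute `σ = φ_s σ'`,
`PreservesMeasure`, group law `flow_add` on the conull carrier); (C) `∫ h̃_x u₊ = S(-x,s)` and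
(D) `∫ h̃_x h̃_y = S(y-x,0)` by STATIONARITY IN SPACE (`h̃_x = h̃_0 ∘ τ_x`, `τ_x` preserves the
shift-invariant `μ`, and the flow commutes with every `τ_x` a.e. — iterated from the unit-shift
hypothesis, `flow_chainShift_ae_of_shift`).  One use of the normal equations cancels the two
`am`-groups: `Σ_x am_x [S(-x,s) - Σ_y ap_y S(y-x,0)] = 0`.  No definitions, no named facts, no sorry.
-/

noncomputable section

open MeasureTheory Filter Set Function
open Literature.MathematicalPhysics.KineticTheory
open Literature.MathematicalPhysics.KineticTheory.HeatConduction
open Literature.MathematicalPhysics.KineticTheory.HeatConduction.OscillatorChain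
open scoped ENNReal

namespace Summit.AtomisticToContinuum.FouriersLaw.Theorems.LocalEnergyHalfHoelder.NashDoubling

/-- **A.e. homogeneity of the flow under every lattice translation.**  If `μ` is shift invariant
and the flow commutes `μ`-a.e. with the unit shift, `φ_t ∘ τ = τ ∘ φ_t`, then it commutes `μ`-a.e.
with every translation `τ_x`, `x ∈ ℤ` (`τ_{x+1} = τ_x ∘ τ_1`, `τ_{-1} = τ_1⁻¹`, and a.e. statements
are transported along the `μ`-preserving maps `τ_{±1}`). [folklore] -/
theorem flow_chainShift_ae_of_shift {P : OscillatorChain} (D : InfiniteChainDynamics P)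
    {μ : Measure ChainConfig} (hSI : IsShiftInvariant μ)
    (hShift : ∀ t : ℝ, ∀ᵐ σ ∂μ, D.flow t (shift σ) = shift (D.flow t σ)) (t : ℝ) (x : ℤ) :
    ∀ᵐ σ ∂μ, D.flow t (chainShift x σ) = chainShift x (D.flow t σ) := by
  have h1 : ∀ᵐ σ ∂μ, D.flow t (chainShift 1 σ) = chainShift 1 (D.flow t σ) := by
    rw [chainShift_one]
    exact hShift t
  have hm1 : ∀ᵐ σ ∂μ, D.flow t (chainShift (-1) σ) = chainShift (-1) (D.flow t σ) := by
    have h' : ∀ᵐ σ ∂μ, D.flow t (shift (chainShift (-1) σ)) = shift (D.flow t (chainShift (-1) σ)) :=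
      (hSI.measurePreserving_chainShift (-1)).quasiMeasurePreserving.ae (hShift t)
    filter_upwards [h'] with σ hσ
    rw [← chainShift_one, ← ShiftAction.apply_add, add_neg_cancel, ShiftAction.apply_zero] at hσ
    rw [hσ, ← ShiftAction.apply_add, neg_add_cancel, ShiftAction.apply_zero]
  induction x with
  | zero => exact Eventually.of_forall fun σ => by simp only [ShiftAction.apply_zero]
  | succ n ih =>
      have ih' : ∀ᵐ σ ∂μ, D.flow t (chainShift (n : ℤ) (chainShift 1 σ)) =
          chainShift (n : ℤ) (D.flow t (chainShift 1 σ)) :=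
        (hSI.measurePreserving_chainShift 1).quasiMeasurePreserving.ae ih
      filter_upwards [ih', h1] with σ hσ hσ1
      rw [ShiftAction.apply_add, hσ, hσ1, ← ShiftAction.apply_add]
  | pred n ih =>
      have ih' : ∀ᵐ σ ∂μ, D.flow t (chainShift (-(n : ℤ)) (chainShift (-1) σ)) =
          chainShift (-(n : ℤ)) (D.flow t (chainShift (-1) σ)) :=
        (hSI.measurePreserving_chainShift (-1)).quasiMeasurePreserving.ae ih
      filter_upwards [ih', hm1] with σ hσ hσ1
      rw [sub_eq_add_neg, ShiftAction.apply_add, hσ, hσ1, ← ShiftAction.apply_add]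

/-- **Unitarity of the Koopman operators** (two observables): `∫ (a ∘ φ_s) · b dμ = ∫ a · (b ∘ φ_{-s}) dμ`
for measurable `a, b` and a `μ`-preserving dynamics (`φ_{-s} ∘ φ_s = id` on the conull carrier,
then the substitution `σ' = φ_s σ`). [folklore] -/
theorem integral_comp_flow_mul_eq {P : OscillatorChain} (D : InfiniteChainDynamics P)
    {μ : Measure ChainConfig} (hD : D.PreservesMeasure μ) {a b : ChainConfig → ℝ}
    (ha : Measurable a) (hb : Measurable b) (s : ℝ) :
    ∫ σ, a (D.flow s σ) * b σ ∂μ = ∫ σ, a σ * b (D.flow (-s) σ) ∂μ := by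
  have hae : (fun σ => a (D.flow s σ) * b σ) =ᵐ[μ]
      fun σ => (fun τ => a τ * b (D.flow (-s) τ)) (D.flow s σ) := by
    filter_upwards [hD.1] with σ hσ
    show a (D.flow s σ) * b σ = a (D.flow s σ) * b (D.flow (-s) (D.flow s σ))
    rw [← D.flow_add hσ, neg_add_cancel, D.flow_zero σ hσ]
  rw [integral_congr_ae hae]
  exact integral_comp_eq_of_measurePreserving (hD.2 s) (ha.mul (hb.comp (hD.2 (-s)).measurable))

/-- **Spatial stationarity of flow correlations**: if `τ_x` preserves `μ` (shift-invariant state)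
and `φ_t ∘ τ_x = τ_x ∘ φ_t` `μ`-a.e., then `∫ (a ∘ τ_x) · (b ∘ τ_x ∘ φ_t) dμ = ∫ a · (b ∘ φ_t) dμ`
for measurable `a, b`. [folklore] -/
theorem integral_comp_chainShift_mul_flow {P : OscillatorChain} (D : InfiniteChainDynamics P)
    {μ : Measure ChainConfig} (hD : D.PreservesMeasure μ) (hSI : IsShiftInvariant μ) {t : ℝ}
    {x : ℤ} (hcomm : ∀ᵐ σ ∂μ, D.flow t (chainShift x σ) = chainShift x (D.flow t σ))
    {a b : ChainConfig → ℝ} (ha : Measurable a) (hb : Measurable b) :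
    ∫ σ, a (chainShift x σ) * b (chainShift x (D.flow t σ)) ∂μ = ∫ σ, a σ * b (D.flow t σ) ∂μ := by
  have hae : (fun σ => a (chainShift x σ) * b (chainShift x (D.flow t σ))) =ᵐ[μ]
      fun σ => (fun ρ => a ρ * b (D.flow t ρ)) (chainShift x σ) := by
    filter_upwards [hcomm] with σ hσ
    show a (chainShift x σ) * b (chainShift x (D.flow t σ)) =
      a (chainShift x σ) * b (D.flow t (chainShift x σ))
    rw [hσ]
  rw [integral_congr_ae hae]
  exact integral_comp_eq_of_measurePreserving (hSI.measurePreserving_chainShift x)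
    (ha.mul (hb.comp (hD.2 t).measurable))

/-- **The doubling identity at finite rank** (stub `stub_doublingIdentity`, signature spelled out).
For the guarded pair `(μ, D)` of the pinned anharmonic chain, the split-bond site energy `h`,
`m = ∫ h_0 dμ`, the pulse `S(x,t) = ∫ (h_0 - m)(h_x∘φ_t - m) dμ`, a time `s`, a window
`W = {-L,…,L}`, a solution `ap` of the normal equations `S(-y,s) = Σ_{x∈W} ap_x S(x-y,0)` (`y ∈ W`)
and any `am`: `∫ (h̃_0∘φ_{-s} - Σ am_x h̃_x)(h̃_0∘φ_s - Σ ap_x h̃_x) dμ = S(0,2s) - Σ_x ap_x S(x,s)`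
(unitarity of the Koopman group, stationarity in space, bilinearity, one use of the normal
equations). [folklore] -/
theorem doublingIdentity : ∀ ω₂ lam β γ : ℝ, 0 < ω₂ → 0 < lam → 0 < β → ∀ T : ℝ, 0 < T → ∀ μ : MeasureTheory.Measure Literature.MathematicalPhysics.KineticTheory.HeatConduction.ChainConfig, (Literature.MathematicalPhysics.KineticTheory.HeatConduction.pinnedChain ω₂ lam β γ).IsChainGibbsMeasure T μ → Literature.MathematicalPhysics.KineticTheory.HeatConduction.IsShiftInvariant μ → μ.map (fun σ : Literature.MathematicalPhysics.KineticTheory.HeatConduction.ChainConfig => fun x : ℤ => ((σ x).1, -(σ x).2)) = μ → ∀ D : Literature.MathematicalPhysics.KineticTheory.HeatConduction.InfiniteChainDynamics (Literature.MathematicalPhysics.KineticTheory.HeatConduction.pinnedChain ω₂ lam β γ), D.PreservesMeasure μ → (∀ t : ℝ, ∀ᵐ σ ∂μ, D.flow t (Literature.MathematicalPhysics.KineticTheory.HeatConduction.shift σ) = Literature.MathematicalPhysics.KineticTheory.HeatConduction.shift (D.flow t σ)) → ∀ h : Literature.MathematicalPhysics.KineticTheory.HeatConduction.ChainConfig → ℤ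 → ℝ, h = (fun (σ : Literature.MathematicalPhysics.KineticTheory.HeatConduction.ChainConfig) (x : ℤ) => (σ x).2 ^ 2 / 2 + (Literature.MathematicalPhysics.KineticTheory.HeatConduction.pinnedChain ω₂ lam β γ).U (σ x).1 + ((Literature.MathematicalPhysics.KineticTheory.HeatConduction.pinnedChain ω₂ lam β γ).V ((σ (x + 1)).1 - (σ x).1) + (Literature.MathematicalPhysics.KineticTheory.HeatConduction.pinnedChain ω₂ lam β γ).V ((σ x).1 - (σ (x - 1)).1)) / 2) → ∀ S : ℤ → ℝ → ℝ, S = (fun (x : ℤ) (t : ℝ) => ∫ σ, (h σ 0 - ∫ σ', h σ' 0 ∂μ) * (h (D.flow t σ) x - ∫ σ', h σ' 0 ∂μ) ∂μ) → (∀ ν : ℝ, 0 < ν → MeasureTheory.IntegrableOn (fun t : ℝ => Real.exp (-(ν * t)) * S 0 t) (Set.Ioi 0)) → ∀ (s : ℝ) (L : ℕ) (ap am : ℤ → ℝ), (∀ y ∈ Finset.Icc (-(L:ℤ)) (L:ℤ), S (-y) s = ∑ x ∈ Finset.Icc (-(L:ℤ)) (L:ℤ), ap x * S (x - y) 0) →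 ∫ σ, ((h (D.flow (-s) σ) 0 - ∫ σ', h σ' 0 ∂μ) - ∑ x ∈ Finset.Icc (-(L:ℤ)) (L:ℤ), am x * (h σ x - ∫ σ', h σ' 0 ∂μ)) * ((h (D.flow s σ) 0 - ∫ σ', h σ' 0 ∂μ) - ∑ x ∈ Finset.Icc (-(L:ℤ)) (L:ℤ), ap x * (h σ x - ∫ σ', h σ' 0 ∂μ)) ∂μ = S 0 (2 * s) - ∑ x ∈ Finset.Icc (-(L:ℤ)) (L:ℤ), ap x * S x s := by
  intro ω₂ lam β γ hω hl hβ T hT μ hG hSI _hRefl D hP hShift h hh S hS _hInt s L ap am hNE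
  haveI : IsProbabilityMeasure μ := hG.isProbabilityMeasure
  have hU : Continuous (pinnedChain ω₂ lam β γ).U := continuous_pinnedChain_U ω₂ lam β γ
  have hV : Continuous (pinnedChain ω₂ lam β γ).V := continuous_pinnedChain_V ω₂ lam β γ
  have hss : (pinnedChain ω₂ lam β γ).HasSuperstabilityEstimate μ :=
    hasSuperstabilityEstimate_of_isShiftInvariant_pinnedChain γ hω hl.le hβ.le hT hG hSI
  -- `h` is the energy density `energyDensityZ`
  have hZ : ∀ (σ : ChainConfig) (z : ℤ), h σ z = (pinnedChain ω₂ lam β γ).energyDensityZ σ z := by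
    intro σ z; subst hh; rfl
  have hfun : ∀ z : ℤ, (fun σ : ChainConfig => h σ z) =
      fun σ => (pinnedChain ω₂ lam β γ).energyDensityZ σ z := fun z => funext fun σ => hZ σ z
  have hmh : ∀ z : ℤ, Measurable fun σ : ChainConfig => h σ z := by
    intro z
    rw [hfun z]
    exact (pinnedChain ω₂ lam β γ).measurable_energyDensityZ hU.measurable hV.measurable z
  have hL2h : ∀ z : ℤ, MemLp (fun σ : ChainConfig => h σ z) 2 μ := by
    intro z
    rw [hfun z]
    exact memLp_energyDensityZ_pinnedChain γ hω.le hl.le hβ.le hss z (by norm_num)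
  have hshift : ∀ (x z : ℤ) (σ : ChainConfig), h (chainShift x σ) z = h σ (z + x) := by
    intro x z σ
    rw [hZ, hZ, energyDensityZ_chainShift]
  set m : ℝ := ∫ σ', h σ' 0 ∂μ
  set W : Finset ℤ := Finset.Icc (-(L:ℤ)) (L:ℤ)
  -- the centred densities `h̃_z = h_z - m` are measurable and square integrable
  have hgm : ∀ z : ℤ, Measurable fun σ : ChainConfig => h σ z - m := fun z => (hmh z).sub_const m
  have hg2 : ∀ z : ℤ, MemLp (fun σ : ChainConfig => h σ z - m) 2 μ :=
    fun z => (hL2h z).sub (memLp_const m)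
  have hSxt : ∀ (x : ℤ) (t : ℝ), S x t = ∫ σ, (h σ 0 - m) * (h (D.flow t σ) x - m) ∂μ := by
    intro x t; rw [hS]
  -- a.e. homogeneity of the flow under all lattice translations
  have hcomm : ∀ (t : ℝ) (x : ℤ), ∀ᵐ σ ∂μ, D.flow t (chainShift x σ) = chainShift x (D.flow t σ) :=
    fun t x => flow_chainShift_ae_of_shift D hSI hShift t x
  -- (A) unitarity: `∫ u₋ u₊ dμ = S(0, 2s)`
  have hA : ∫ σ, (h (D.flow (-s) σ) 0 - m) * (h (D.flow s σ) 0 - m) ∂μ = S 0 (2 * s) := by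
    rw [hSxt, D.integral_comp_flow_mul_comp_flow_eq hP (hgm 0) (-s) s, show s - -s = 2 * s by ring]
  -- (B) unitarity: `∫ u₋ h̃ₓ dμ = S(x, s)`
  have hB : ∀ x : ℤ, ∫ σ, (h (D.flow (-s) σ) 0 - m) * (h σ x - m) ∂μ = S x s := by
    intro x
    rw [hSxt, integral_comp_flow_mul_eq D hP (hgm 0) (hgm x) (-s), neg_neg]
  -- (C) stationarity in space: `∫ h̃ₓ u₊ dμ = S(-x, s)`
  have hC : ∀ x : ℤ, ∫ σ, (h σ x - m) * (h (D.flow s σ) 0 - m) ∂μ = S (-x) s := by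
    intro x
    rw [hSxt, ← integral_comp_chainShift_mul_flow D hP hSI (hcomm s x) (hgm 0) (hgm (-x))]
    refine integral_congr_ae (Eventually.of_forall fun σ => ?_)
    simp only [hshift, zero_add, neg_add_cancel]
  -- (D) static stationarity: `∫ h̃ₓ h̃_y dμ = S(y - x, 0)` (`φ_0 = id` a.e.)
  have hD : ∀ x y : ℤ, ∫ σ, (h σ x - m) * (h σ y - m) ∂μ = S (y - x) 0 := by
    intro x y
    have hmeas : Measurable fun σ : ChainConfig => (h σ 0 - m) * (h σ (y - x) - m) :=
      (hgm 0).mul (hgm (y - x))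
    rw [hSxt]
    symm
    calc ∫ σ, (h σ 0 - m) * (h (D.flow 0 σ) (y - x) - m) ∂μ
        = ∫ σ, (h σ 0 - m) * (h σ (y - x) - m) ∂μ := by
          refine integral_congr_ae ?_
          filter_upwards [D.flow_zero_ae_eq hP] with σ hσ
          rw [hσ]
      _ = ∫ σ, (fun σ : ChainConfig => (h σ 0 - m) * (h σ (y - x) - m)) (chainShift x σ) ∂μ :=
          (integral_comp_eq_of_measurePreserving (hSI.measurePreserving_chainShift x) hmeas).symm
      _ = ∫ σ, (h σ x - m) * (h σ y - m) ∂μ := by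
          simp only [hshift, zero_add, sub_add_cancel]
  -- integrability of the four groups of terms (products of `L²` functions)
  have h2m : MemLp (fun σ : ChainConfig => h (D.flow (-s) σ) 0 - m) 2 μ :=
    (hg2 0).comp_measurePreserving (hP.2 (-s))
  have h2p : MemLp (fun σ : ChainConfig => h (D.flow s σ) 0 - m) 2 μ :=
    (hg2 0).comp_measurePreserving (hP.2 s)
  have hIA : Integrable (fun σ : ChainConfig =>
      (h (D.flow (-s) σ) 0 - m) * (h (D.flow s σ) 0 - m)) μ := h2m.integrable_mul h2p
  have hIB : ∀ x : ℤ, Integrable (fun σ : ChainConfig =>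
      ap x * ((h (D.flow (-s) σ) 0 - m) * (h σ x - m))) μ :=
    fun x => (h2m.integrable_mul (hg2 x)).const_mul (ap x)
  have hIC : ∀ x : ℤ, Integrable (fun σ : ChainConfig =>
      am x * ((h σ x - m) * (h (D.flow s σ) 0 - m))) μ :=
    fun x => ((hg2 x).integrable_mul h2p).const_mul (am x)
  have hID : ∀ x y : ℤ, Integrable (fun σ : ChainConfig =>
      am x * ap y * ((h σ x - m) * (h σ y - m))) μ :=
    fun x y => ((hg2 x).integrable_mul (hg2 y)).const_mul (am x * ap y)
  have hIBs : Integrable (fun σ : ChainConfig =>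
      ∑ x ∈ W, ap x * ((h (D.flow (-s) σ) 0 - m) * (h σ x - m))) μ :=
    integrable_finsetSum W fun x _ => hIB x
  have hICs : Integrable (fun σ : ChainConfig =>
      ∑ x ∈ W, am x * ((h σ x - m) * (h (D.flow s σ) 0 - m))) μ :=
    integrable_finsetSum W fun x _ => hIC x
  have hIDs : Integrable (fun σ : ChainConfig =>
      ∑ x ∈ W, ∑ y ∈ W, am x * ap y * ((h σ x - m) * (h σ y - m))) μ :=
    integrable_finsetSum W fun x _ => integrable_finsetSum W fun y _ => hID x y
  have hI1 : Integrable (fun σ : ChainConfig =>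
      (h (D.flow (-s) σ) 0 - m) * (h (D.flow s σ) 0 - m)
        - ∑ x ∈ W, ap x * ((h (D.flow (-s) σ) 0 - m) * (h σ x - m))) μ := hIA.sub hIBs
  have hI2 : Integrable (fun σ : ChainConfig =>
      (h (D.flow (-s) σ) 0 - m) * (h (D.flow s σ) 0 - m)
        - (∑ x ∈ W, ap x * ((h (D.flow (-s) σ) 0 - m) * (h σ x - m)))
        - ∑ x ∈ W, am x * ((h σ x - m) * (h (D.flow s σ) 0 - m))) μ := hI1.sub hICs
  -- pointwise bilinear expansion of the integrand
  have hexp : ∀ σ : ChainConfig,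
      ((h (D.flow (-s) σ) 0 - m) - ∑ x ∈ W, am x * (h σ x - m)) *
        ((h (D.flow s σ) 0 - m) - ∑ x ∈ W, ap x * (h σ x - m)) =
      (h (D.flow (-s) σ) 0 - m) * (h (D.flow s σ) 0 - m)
        - (∑ x ∈ W, ap x * ((h (D.flow (-s) σ) 0 - m) * (h σ x - m)))
        - (∑ x ∈ W, am x * ((h σ x - m) * (h (D.flow s σ) 0 - m)))
        + ∑ x ∈ W, ∑ y ∈ W, am x * ap y * ((h σ x - m) * (h σ y - m)) := by
    intro σ
    have e1 : (h (D.flow (-s) σ) 0 - m) * (∑ x ∈ W, ap x * (h σ x - m)) =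
        ∑ x ∈ W, ap x * ((h (D.flow (-s) σ) 0 - m) * (h σ x - m)) := by
      rw [Finset.mul_sum]
      exact Finset.sum_congr rfl fun x _ => by ring
    have e2 : (∑ x ∈ W, am x * (h σ x - m)) * (h (D.flow s σ) 0 - m) =
        ∑ x ∈ W, am x * ((h σ x - m) * (h (D.flow s σ) 0 - m)) := by
      rw [Finset.sum_mul]
      exact Finset.sum_congr rfl fun x _ => by ring
    have e3 : (∑ x ∈ W, am x * (h σ x - m)) * (∑ x ∈ W, ap x * (h σ x - m)) =
        ∑ x ∈ W, ∑ y ∈ W, am x * ap y * ((h σ x - m) * (h σ y - m)) := by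
      rw [Finset.sum_mul_sum]
      exact Finset.sum_congr rfl fun x _ => Finset.sum_congr rfl fun y _ => by ring
    rw [← e1, ← e2, ← e3]
    ring
  -- the four integrals
  have hBsum : ∫ σ, ∑ x ∈ W, ap x * ((h (D.flow (-s) σ) 0 - m) * (h σ x - m)) ∂μ =
      ∑ x ∈ W, ap x * S x s := by
    rw [integral_finsetSum W (fun x _ => hIB x)]
    refine Finset.sum_congr rfl fun x _ => ?_
    rw [integral_const_mul, hB x]
  have hCsum : ∫ σ, ∑ x ∈ W, am x * ((h σ x - m) * (h (D.flow s σ) 0 - m)) ∂μ =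
      ∑ x ∈ W, am x * S (-x) s := by
    rw [integral_finsetSum W (fun x _ => hIC x)]
    refine Finset.sum_congr rfl fun x _ => ?_
    rw [integral_const_mul, hC x]
  have hDsum : ∫ σ, ∑ x ∈ W, ∑ y ∈ W, am x * ap y * ((h σ x - m) * (h σ y - m)) ∂μ =
      ∑ x ∈ W, ∑ y ∈ W, am x * ap y * S (y - x) 0 := by
    rw [integral_finsetSum W (fun x _ => integrable_finsetSum W (fun y _ => hID x y))]
    refine Finset.sum_congr rfl fun x _ => ?_
    rw [integral_finsetSum W (fun y _ => hID x y)]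
    refine Finset.sum_congr rfl fun y _ => ?_
    rw [integral_const_mul, hD x y]
  -- ONE use of the normal equations: the `am`-cross terms cancel
  have hsumC : ∑ x ∈ W, am x * S (-x) s = ∑ x ∈ W, ∑ y ∈ W, am x * ap y * S (y - x) 0 := by
    refine Finset.sum_congr rfl fun x hx => ?_
    rw [hNE x hx, Finset.mul_sum]
    exact Finset.sum_congr rfl fun y _ => by ring
  calc ∫ σ, ((h (D.flow (-s) σ) 0 - m) - ∑ x ∈ W, am x * (h σ x - m)) *
          ((h (D.flow s σ) 0 - m) - ∑ x ∈ W, ap x * (h σ x - m)) ∂μ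
      = ∫ σ, ((h (D.flow (-s) σ) 0 - m) * (h (D.flow s σ) 0 - m)
          - (∑ x ∈ W, ap x * ((h (D.flow (-s) σ) 0 - m) * (h σ x - m)))
          - (∑ x ∈ W, am x * ((h σ x - m) * (h (D.flow s σ) 0 - m)))
          + ∑ x ∈ W, ∑ y ∈ W, am x * ap y * ((h σ x - m) * (h σ y - m))) ∂μ :=
        integral_congr_ae (Eventually.of_forall hexp)
    _ = S 0 (2 * s) - (∑ x ∈ W, ap x * S x s) - (∑ x ∈ W, am x * S (-x) s)
          + ∑ x ∈ W, ∑ y ∈ W, am x * ap y * S (y - x) 0 := by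
        rw [integral_add hI2 hIDs, integral_sub hI1 hICs, integral_sub hIA hIBs, hA, hBsum, hCsum,
          hDsum]
    _ = S 0 (2 * s) - ∑ x ∈ W, ap x * S x s := by
        rw [hsumC]
        ring

/-- **stub `stub_doublingIdentity` (DYNAMICS, provable now; size L) — the card's first lemma `DoublingIdentityFiniteRank`.** For every time `s`, window `L`, every solution `ap` of the finite normal equations `S(−y,s) = Σₓ apₓ S(x−y,0)` (`|y| ≤ L`; i.e. `Σ apₓh̃ₓ = P_L(h̃₀∘φₛ)`) and EVERY `am`, the debris integral `∫ (h̃₀∘φ₋ₛ − Σ amₓh̃ₓ)(h̃₀∘φₛ − Σ apₓh̃ₓ) dμ` equals `S(0,2s) − Σₓ apₓ S(x,s)`. Ingredients: `h̃ₓ ∈ L²(μ)` (superstability of the shift-invariant DLR state); UNITARITY — `∫ (h̃₀∘φ₋ₛ)(h̃₀∘φₛ) dμ = S(0,2s)` and `∫ (h̃₀∘φ₋ₛ) h̃ₓ dμ = S(x,s)` by `PreservesMeasure` (substitute `σ = φₛσ'`) and the group law `φ₋ₛ∘φₛ = id`, `φₛ∘φₛ = φ₂ₛ` on the conull carrier (`flow_add`);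 STATIONARITY IN SPACE — `∫ h̃ₓ (h̃₀∘φₛ) dμ = S(−x,s)` and `∫ h̃ₓh̃_y dμ = S(y−x,0)` by shift invariance of `μ` and a.e. shift covariance of the flow; then bilinearity and ONE use of the normal equations (the `am`-cross terms cancel: `Σₓ amₓ[S(−x,s) − Σ_y ap_y S(y−x,0)] = 0`). -/
abbrev Stmt.stub_doublingIdentity : Prop :=
    ∀ ω₂ lam β γ : ℝ, 0 < ω₂ → 0 < lam → 0 < β → ∀ T : ℝ, 0 < T → ∀ μ : MeasureTheory.Measure Literature.MathematicalPhysics.KineticTheory.HeatConduction.ChainConfig, (Literature.MathematicalPhysics.KineticTheory.HeatConduction.pinnedChain ω₂ lam β γ).IsChainGibbsMeasure T μ → Literature.MathematicalPhysics.KineticTheory.HeatConduction.IsShiftInvariant μ → μ.map (fun σ : Literature.MathematicalPhysics.KineticTheory.HeatConduction.ChainConfig => fun x : ℤ => ((σ x).1, -(σ x).2)) = μ → ∀ D : Literature.MathematicalPhysics.KineticTheory.HeatConduction.InfiniteChainDynamics (Literature.MathematicalPhysics.KineticTheory.HeatConduction.pinnedChain ω₂ lam β γ), D.PreservesMeasure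 μ → (∀ t : ℝ, ∀ᵐ σ ∂μ, D.flow t (Literature.MathematicalPhysics.KineticTheory.HeatConduction.shift σ) = Literature.MathematicalPhysics.KineticTheory.HeatConduction.shift (D.flow t σ)) → ∀ h : Literature.MathematicalPhysics.KineticTheory.HeatConduction.ChainConfig → ℤ → ℝ, h = (fun (σ : Literature.MathematicalPhysics.KineticTheory.HeatConduction.ChainConfig) (x : ℤ) => (σ x).2 ^ 2 / 2 + (Literature.MathematicalPhysics.KineticTheory.HeatConduction.pinnedChain ω₂ lam β γ).U (σ x).1 + ((Literature.MathematicalPhysics.KineticTheory.HeatConduction.pinnedChain ω₂ lam β γ).V ((σ (x + 1)).1 - (σ x).1) + (Literature.MathematicalPhysics.KineticTheory.HeatConduction.pinnedChain ω₂ lam β γ).V ((σ x).1 - (σ (x - 1)).1)) / 2) → ∀ S : ℤ → ℝ → ℝ, S = (fun (x : ℤ) (t : ℝ) => ∫ σ, (h σ 0 - ∫ σ', h σ' 0 ∂μ) * (h (D.flow t σ) x - ∫ σ', h σ' 0 ∂μ) ∂μ) → (∀ ν : ℝ, 0 < ν → MeasureTheory.IntegrableOn (fun t : ℝ => Real.exp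 (-(ν * t)) * S 0 t) (Set.Ioi 0)) → ∀ (s : ℝ) (L : ℕ) (ap am : ℤ → ℝ), (∀ y ∈ Finset.Icc (-(L:ℤ)) (L:ℤ), S (-y) s = ∑ x ∈ Finset.Icc (-(L:ℤ)) (L:ℤ), ap x * S (x - y) 0) → ∫ σ, ((h (D.flow (-s) σ) 0 - ∫ σ', h σ' 0 ∂μ) - ∑ x ∈ Finset.Icc (-(L:ℤ)) (L:ℤ), am x * (h σ x - ∫ σ', h σ' 0 ∂μ)) * ((h (D.flow s σ) 0 - ∫ σ', h σ' 0 ∂μ) - ∑ x ∈ Finset.Icc (-(L:ℤ)) (L:ℤ), ap x * (h σ x - ∫ σ', h σ' 0 ∂μ)) ∂μ = S 0 (2 * s) - ∑ x ∈ Finset.Icc (-(L:ℤ)) (L:ℤ), ap x * S x s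

/-- **Registered stub `stub_doublingIdentity`** (type `Stmt.stub_doublingIdentity`, verbatim the
skeleton's): the time-reversal doubling identity at finite rank for the guarded pinned chain
(`doublingIdentity`). [folklore] -/
theorem stub_doublingIdentity : Stmt.stub_doublingIdentity :=
  doublingIdentity

end Summit.AtomisticToContinuum.FouriersLaw.Theorems.LocalEnergyHalfHoelder.NashDoubling

end
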